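import Literature.Barriers.QuantumAdvantage.AaronsonChenCor52Holds
import Literature.Computability.QuantumComplexity.OraclePreprocessWrap
import HarnessLib

/-!
# Aaronson–Chen's non-relativization barrier in the FIXED-PROBLEM form, and what an escaping hypothesis must look like

Proof file (theorems only, no definitions, no named facts; D-0014 append protocol — a sibling of
the barrier entry `SupremacyTheoremsNonRelativizing.lean` and of its support file
`AaronsonChenOracle.lean`, written as the outcome of the D-0021 barrier audit of the latter,
2026-08-16).

**Audit findings recorded here as theorems.** The entry's template (b),
`O ↦ (SampBQP^O ⊆ SampBPP^O → PH^O collapses)` (`not_relativizes_sampling_collapse_template`),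
quantifies the HYPOTHESIS over the fully relativized quantum class `SampBQP^O`. The strong
supremacy theorems actually sought — Aaronson–Arkhipov for `BosonSampling`, Bremner–Montanaro–
Shepherd for `IQP`, random circuit sampling — have a weaker-looking hypothesis: ONE explicit,
oracle-free quantum sampling problem `D ∈ SampBQP` is classically easy [cite: AaronsonChen2017, §1 (p. 8)]
[cite: AaronsonArkhipov2013, §1]. Since an oracle-free uniform family has the same output law
relative to every oracle (`SampBQP_subset_SampBQPRel`, from the tree's
`OracleWrap.kernel_eq_of_isOracleFree`), the Aaronson–Chen world `O' = TQBF ⊕ O` of Cor. 5.2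
[cite: AaronsonChen2017, Cor. 5.2 (p. 21)] kills these templates too:

* `not_relativizes_fixed_sampling_collapse_template` — for every `D ∈ SampBQP`,
  `O ↦ (D ∈ SampBPP^O → PH^O collapses)` does not relativize (collapse as weak as
  `¬ IsInfinitePHRel`; primed version with the literal `∃ k, Σₖ^O = Σₖ₊₁^O`);
* `not_relativizes_sampBQP_collapse_template` — nor does
  `O ↦ (SampBQP ⊆ SampBPP^O → PH^O collapses)` (all explicit quantum samplers classically easy);
* hypothesis-free forms `…_holds`, fed with the tree's discharge `aaronsonChen2017_cor52_holds`.

**Where a relativizing CONDITIONAL supremacy theorem can live.** Aaronson–Arkhipov's theorem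
"PGC ⟹ (`SampBPP = SampBQP` ⟹ `P^{#P} = BPP^{NP}`)" is proved by an argument that relativizes
once its hypothesis is relativized along (`PGC^O`: Gaussian permanent estimation is `#P^O`-hard)
[cite: AaronsonChen2017, §1 (p. 8, eq. (1))]. `not_relativizes_sampling_collapse_template_with` /
`hypothesis_fails_at_ac_world` record the only way this is compatible with the barrier: an
oracle-indexed side hypothesis `H` under which template (b) DOES relativize must FAIL at every
Aaronson–Chen world (`SampBPP^A = SampBQP^A`, `PH^A` infinite). Hardness statements about explicit
functions (the permanent, Ising partition functions, output amplitudes of explicit circuit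
families; `#P`-checkability as used by Marshall–Aaronson–Dunjko, "the proof contained herein does
not relativise as we rely on the checkability of `#P`") are of this kind, which is why that whole
line of work lies outside the entry's technique class `Relativizes`
[cite: MarshallAaronsonDunjko2024, §1 (p. 2) and §5 (p. 12)]; its binding constraint is the
additive-robustness gap of worst-to-average-case reductions, catalogued separately
(`Literature.Barriers.QuantumAdvantage.UncorrectedNoise`, part (B))
[cite: BoulandFeffermanLandauLiu2022, §3] [cite: HangleiterEisert2023, §4.4.6 (Discussion; arXiv numbering)].

Scope notes of the audit (not formalized): the barrier is relativizing-only — Aaronson–Chen do not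
claim an algebrizing (Aaronson–Wigderson / Impagliazzo–Kabanets–Kolokolova) version of Cor. 5.2,
none is vendored in the tree, the audit's literature search found none, and the sibling entry
`Algebrization.lean` covers `BQP` versus `BPP` only [cite: AaronsonWigderson2008, Thm. 5.11 (v)];
and it is specific to samplers whose cost is polynomial in `1/ε` (input `⟨x, 0^{1/ε}⟩`,
[cite: AaronsonChen2017, Def. 2.3 (p. 12)]): exact or multiplicative-error simulation collapses `PH`
by a relativizing argument [cite: AaronsonChen2017, §1 (p. 2, p. 8)].

## Sources

* [AaronsonChen2017] S. Aaronson, L. Chen, *Complexity-theoretic foundations of quantum supremacy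
  experiments*, CCC 2017 (arXiv:1612.05903, held; `lit read arxiv:1612.05903`): §1 p. 8 ("any
  strong supremacy theorem … along the lines of what Aaronson and Arkhipov and Bremner, Montanaro,
  and Shepherd were seeking, must use non-relativizing techniques"; eq. (1)), Def. 2.3 (p. 12),
  Thm. 5.1 / Cor. 5.2 (p. 21).
* [AaronsonArkhipov2013] S. Aaronson, A. Arkhipov, *The computational complexity of linear optics*,
  Theory of Computing 9 (2013), §1 (the `BosonSampling` programme; PGC).
* [MarshallAaronsonDunjko2024] S. C. Marshall, S. Aaronson, V. Dunjko, arXiv:2410.20935 (read via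
  `lit read arxiv:2410.20935`): p. 2 ("the proof contained herein does not relativise as we rely on
  the checkability of #P"), p. 12 (open question whether their main theorem relativises).
* [BoulandFeffermanLandauLiu2022] §3 (the noise barrier for noise-agnostic reductions), as
  catalogued in `UncorrectedNoise.lean`.
* [HangleiterEisert2023] D. Hangleiter, J. Eisert, Rev. Mod. Phys. 95, 035001 (arXiv:2206.04079,
  held): §4.4.3–§4.4.6, "Discussion" (arXiv numbering) (robustness `2^{-O(m)}` achieved versus `2^{-n}` needed; Paturi
  instability; Aaronson–Arkhipov §9.2).
* [AaronsonWigderson2008] Thm. 5.11 (v), as catalogued in `Algebrization.lean`.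
-/

noncomputable section

namespace Literature.Barriers.QuantumAdvantage

open _root_.Computability Literature.Computability.Complexity Literature.Computability.Complexity.Classes
  Literature.Computability.Cryptography Literature.Computability.QuantumComplexity PneNP

/-! ### Oracle-free quantum samplers are oracle-monotone -/

/-- **`SampBQP ⊆ SampBQP^A` for every oracle language `A`**: an oracle-free uniform Clifford+T
family is a family with (no) oracle gates, and its output kernel does not depend on the oracle
(`OracleWrap.kernel_eq_of_isOracleFree`), so the unrelativized class embeds in every relativized
one — the monotonicity used tacitly whenever a fixed explicit experiment (`BosonSampling`, `IQP`,
random circuits) is placed inside `SampBQP^O`. Generalizes `SampBQP_subset_SampBQPRel_zero`.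
[cite: AaronsonChen2017, Def. 2.3 (p. 12, oracle versions "in the natural way")] -/
theorem SampBQP_subset_SampBQPRel (A : Language Bool) : SampBQP ⊆ SampBQPRel A := by
  rintro D ⟨F, post, hfree, hU, hpost, h⟩
  refine ⟨F, post, hU, hpost, fun x k hk => ?_⟩
  rw [OracleWrap.kernel_eq_of_isOracleFree hfree A 0]
  exact h x k hk

/-! ### Template (b) in the fixed-problem form -/

/-- **The fixed-problem supremacy template does not relativize**: for every explicit quantum
sampling problem `D ∈ SampBQP`, the oracle-indexed statement
`O ↦ (D ∈ SampBPP^O → PH^O collapses)` — "if THIS experiment is classically easy then the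
polynomial hierarchy collapses", the shape sought for `BosonSampling` / `IQP` — fails at the
Aaronson–Chen oracle `O' = TQBF ⊕ O`, where `D ∈ SampBQP ⊆ SampBQP^{O'} = SampBPP^{O'}` while
`PH^{O'}` is infinite. [cite: AaronsonChen2017, Cor. 5.2 (p. 21) and §1 (p. 8)] -/
theorem not_relativizes_fixed_sampling_collapse_template (h : aaronsonChen2017_cor52)
    {D : SamplingProblem} (hD : D ∈ SampBQP) :
    ¬ Relativizes fun O => D ∈ SampPRel O → ¬ IsInfinitePHRel O := by
  obtain ⟨A, hA, hPH⟩ := h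
  intro hrel
  refine hrel A ?_ hPH
  rw [hA]
  exact SampBQP_subset_SampBQPRel A hD

/-- The same with the literal collapse conclusion `∃ k, Σₖ^O = Σₖ₊₁^O`.
[cite: AaronsonChen2017, Cor. 5.2 (p. 21)] -/
theorem not_relativizes_fixed_sampling_collapse_template' (h : aaronsonChen2017_cor52)
    {D : SamplingProblem} (hD : D ∈ SampBQP) :
    ¬ Relativizes fun O => D ∈ SampPRel O → ∃ k, SigmaPRel O k = SigmaPRel O (k + 1) := by
  intro hrel
  refine not_relativizes_fixed_sampling_collapse_template h hD fun A hDA hinf => ?_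
  obtain ⟨k, hk⟩ := hrel A hDA
  exact hinf k hk

/-- **Nor does "all explicit quantum samplers are classically easy ⟹ `PH` collapses"**:
`O ↦ (SampBQP ⊆ SampBPP^O → PH^O collapses)`, with the UNRELATIVIZED quantum class in the
hypothesis, fails at the Aaronson–Chen oracle. [cite: AaronsonChen2017, Cor. 5.2 (p. 21) and §1 (p. 8)] -/
theorem not_relativizes_sampBQP_collapse_template (h : aaronsonChen2017_cor52) :
    ¬ Relativizes fun O => SampBQP ⊆ SampPRel O → ¬ IsInfinitePHRel O := by
  obtain ⟨A, hA, hPH⟩ := h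
  intro hrel
  refine hrel A ?_ hPH
  rw [hA]
  exact SampBQP_subset_SampBQPRel A

/-! ### Side hypotheses: a relativizing conditional theorem needs a hypothesis false at every Aaronson–Chen world -/

/-- **Template (b) under a side hypothesis `H` that HOLDS at an Aaronson–Chen world still fails to
relativize**: if `SampBPP^A = SampBQP^A`, `PH^A` is infinite and `H` holds relative to `A`, then
`O ↦ (H O → SampBQP^O ⊆ SampBPP^O → PH^O collapses)` is false at `A` (any presentation `S` of
`SampBQP^·`). [cite: AaronsonChen2017, Cor. 5.2 (p. 21)] -/
theorem not_relativizes_sampling_collapse_template_with (H : Oracle → Prop) {A : Language Bool}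
    (hA : SampPRel (Oracle.ofLanguage A) = SampBQPRel A) (hPH : IsInfinitePHRel (Oracle.ofLanguage A))
    (hH : H (Oracle.ofLanguage A)) {S : Oracle → Set SamplingProblem} (hS : PresentsSampBQPRel S) :
    ¬ Relativizes fun O => H O → S O ⊆ SampPRel O → ¬ IsInfinitePHRel O := by
  intro hrel
  refine hrel A hH ?_ hPH
  rw [hS A, ← hA]

/-- **Contrapositive, the positive reading**: if the conditional template
`O ↦ (H O → SampBQP^O ⊆ SampBPP^O → PH^O collapses)` DOES relativize — as Aaronson–Arkhipov's
"PGC ⟹ strong supremacy theorem" does once `PGC` is read relative to the oracle — then `H` fails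
at every Aaronson–Chen world. Hypotheses about explicit functions (`#P`-hardness of the permanent,
`#P`-checkability) are of this kind. [cite: AaronsonChen2017, §1 (p. 8, eq. (1)) and Cor. 5.2 (p. 21)] [cite: MarshallAaronsonDunjko2024, §1 (p. 2)] -/
theorem hypothesis_fails_at_ac_world (H : Oracle → Prop) {S : Oracle → Set SamplingProblem}
    (hS : PresentsSampBQPRel S)
    (hrel : Relativizes fun O => H O → S O ⊆ SampPRel O → ¬ IsInfinitePHRel O)
    {A : Language Bool} (hA : SampPRel (Oracle.ofLanguage A) = SampBQPRel A)
    (hPH : IsInfinitePHRel (Oracle.ofLanguage A)) : ¬ H (Oracle.ofLanguage A) :=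
  fun hH => not_relativizes_sampling_collapse_template_with H hA hPH hH hS hrel

/-- In particular some oracle falsifies any such `H` (the Aaronson–Chen oracle exists:
`aaronsonChen2017_cor52`). [cite: AaronsonChen2017, Cor. 5.2 (p. 21)] -/
theorem exists_oracle_hypothesis_fails (h : aaronsonChen2017_cor52) (H : Oracle → Prop)
    {S : Oracle → Set SamplingProblem} (hS : PresentsSampBQPRel S)
    (hrel : Relativizes fun O => H O → S O ⊆ SampPRel O → ¬ IsInfinitePHRel O) :
    ∃ A : Language Bool, ¬ H (Oracle.ofLanguage A) := by
  obtain ⟨A, hA, hPH⟩ := h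
  exact ⟨A, hypothesis_fails_at_ac_world H hS hrel hA hPH⟩

/-! ### Hypothesis-free forms (the barrier fact is discharged in the tree) -/

/-- The fixed-problem template, with no hypothesis left but `D ∈ SampBQP`
(`aaronsonChen2017_cor52_holds`). [cite: AaronsonChen2017, Cor. 5.2 (p. 21) and §1 (p. 8)] -/
theorem not_relativizes_fixed_sampling_collapse_template_holds {D : SamplingProblem}
    (hD : D ∈ SampBQP) : ¬ Relativizes fun O => D ∈ SampPRel O → ¬ IsInfinitePHRel O :=
  not_relativizes_fixed_sampling_collapse_template aaronsonChen2017_cor52_holds hD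

/-- "`SampBQP ⊆ SampBPP^O ⟹ PH^O` collapses" does not relativize, with no hypothesis.
[cite: AaronsonChen2017, Cor. 5.2 (p. 21) and §1 (p. 8)] -/
theorem not_relativizes_sampBQP_collapse_template_holds :
    ¬ Relativizes fun O => SampBQP ⊆ SampPRel O → ¬ IsInfinitePHRel O :=
  not_relativizes_sampBQP_collapse_template aaronsonChen2017_cor52_holds

/-- Some oracle falsifies every side hypothesis under which template (b) relativizes, with no
hypothesis (canonical presentation `sampBQPRelOf`). [cite: AaronsonChen2017, Cor. 5.2 (p. 21)] -/
theorem exists_oracle_hypothesis_fails_holds (H : Oracle → Prop)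
    (hrel : Relativizes fun O => H O → sampBQPRelOf O ⊆ SampPRel O → ¬ IsInfinitePHRel O) :
    ∃ A : Language Bool, ¬ H (Oracle.ofLanguage A) :=
  exists_oracle_hypothesis_fails aaronsonChen2017_cor52_holds H presentsSampBQPRel_sampBQPRelOf hrel

end Literature.Barriers.QuantumAdvantage

end
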